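import Summits.BirchSwinnertonDyer.BirchSwinnertonDyer.Theorems.GenusKolyvaginAtTwoKramerParityBridgeCount
import Summits.BirchSwinnertonDyer.Rank1Residual.X11b.BDPRouteSelmerLevelBound
import Summits.BirchSwinnertonDyer.Rank1Residual.X11b.CongruentSelmerTransferTransport
import Literature.NumberTheory.EllipticCurves.MazurRubin2010.TwistSelmerParity
import HarnessLib

/-!
# Route `GenusKolyvaginAtTwo`, crux #2 `GenusPrimitiveSupplyAtTwo` (stmt-BirchSwinnertonDyer-22136):
# KRAMER PARITY VIA QUADRATIC SELMER STRUCTURES, part 3 — KMR Theorem 3.9 INSTANTIATED on the Kummer structure of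
# `E[2]`, and `MazurRubin2010.kramerParity K` REDUCED to a Tate-quadratic-form datum (Poonen–Rains §4), all duality
# inputs taken from a Poitou–Tate family

Width seat `bsd-line-gk2-p4` g11 (cell `bsd-f1-sign2`), the F5-BRIDGE of the lead's (gk2-p1 g10) programme «Poonen–Rains
quadratic refinement of the local Tate pairing at `2` ⟹ `MazurRubin2010.kramerParity_holds`» (files F1–F4 of the lead build the
datum; this file is the `q`-INDEPENDENT half). THEOREMS ONLY (no definition, no named fact, no `sorry`); helper
`--supports stmt-BirchSwinnertonDyer-22136`; no item is closed; BSD is not proved by any of this.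

* §3 **`isSquare_card_selmerGroup_mul_of_tateQuadraticForms` (THE ENGINE)** — Klagsbrun–Mazur–Rubin 2013 Thm. 3.9 for the
  Kummer structure `𝓚` of `E[2]` and a second `q`-isotropic Selmer structure `𝓐` agreeing with `𝓚` off `S` with `#𝓐_v = #𝓚_v`:
  given functions `q_v : H¹(K_v, E[2]) → ℤ/2` with (Q1) polarisation `inv_v(· ∪ₑ ·)`, (Q2) `q_v(𝓚_v) = 0`, (Q3) reciprocity,
  `#H¹_𝓐 · #H¹_𝓚 · ∏_{v∈S} [𝓚_v : 𝓐_v ∩ 𝓚_v]` is a square. The `q_v` are made a `GlobalMetabolicStructure` (KMR Def. 3.3) on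
  `H¹(K, E[2])` with `Λ_v := 𝓚_v` (Lagrangian at EVERY place, part 1 §1) and `S₀ = ∅`; `Z^⊥ = Z` is part 1 §2 (+ X11b
  `KummerPT.sum_invWeilPairing_localization_eq_zero_of_mem_kummerOutside`); finiteness is X11b `finite_kummerOutside`.
* §4 **`kramerParity_of_tateQuadraticForms`** — `MazurRubin2010.kramerParity K` (Kramer 1981 Thm. 1 = MR 2010 Thm. 2.7, every
  number field, `p = 2`) from a family `inv` with the five Poitou–Tate properties and, for every elliptic `E/K`, a Weil pairing
  and a datum (Q1)–(Q4) ((Q4) = `q_v` kills the transported Kummer condition of every quadratic twist; binders verbatim as in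
  `kramerParity`): `#𝓐_v = #𝓚_v` by part 2 and the transport `E^F[2] ≅ E[2]` (X11b `natCard_selmerGroup_of_transport`).
* (part 4, `…KramerParityOfTateQuadraticFormsCanonical`) the same with (Q1) for THE canonical invariant maps and NO duality
  hypothesis left.

So the lead's F5 («metabolic structure + `kramerParity_holds`») is: supply, for every elliptic `W/K`, `e` and `q` with
(Q1)–(Q4) for `LocalInvariants.canonical K 2` — (Q1) = Zarhin/PR Cor. 4.6 (`HeisenbergDatum.conn_add`), (Q2)/(Q4) = PR
Prop. 4.11 (Kummer isotropy; twist-invariance of the level-2 Heisenberg datum), (Q3) = Brauer reciprocity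
`sumInvLocalizationEqZero_canonical_of_numberField` — and apply §5. Honest framing: this is a CONDITIONAL reduction; nothing of
Poonen–Rains §4 is proved here; crux 22136 stays OPEN at (U) ∧ (CONV₂); BSD is not proved by any of this.

References: [KlagsbrunMazurRubin2013] Def. 3.3, Def. 3.8, Thm. 3.9, Lemma 5.2 (arXiv:1111.2321); [MazurRubin2010] Thm. 2.7,
Remark 2.4, Lemma 2.9, Cor. 3.4 (arXiv:0904.3709); [Kramer1981] Thm. 1; [PoonenRains2012] Prop. 4.9, Prop. 4.11, Thm. 4.14;
[MilneADT2006] I Ex. 1.6 (c), Cor. 2.3, Thm. 2.8, Thm. 2.13, Thm. 4.10 (b); [Howard2004HeegnerKolyvagin] Thm. 2.1.11.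
-/

set_option linter.dupNamespace false -- tree convention: `Summit.BirchSwinnertonDyer.BirchSwinnertonDyer.Theorems` (summit = sub-problem)
set_option autoImplicit false

noncomputable section

open scoped Classical ContRepresentation

namespace Summit.BirchSwinnertonDyer.BirchSwinnertonDyer.Theorems.GenusKolyKramer

open WeierstrassCurve Field NumberField IsDedekindDomain Function Module
open Literature.NumberTheory.EllipticCurves Literature.NumberTheory.GaloisRepresentations
open Literature.NumberTheory.GaloisRepresentations.DiscreteGaloisModule (SelmerStructure mu MuCarrier localTatePairingZMod tateDual)
open Literature.NumberTheory.GaloisCohomology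
open Literature.LinearAlgebra.QuadraticForm
open Summit.BirchSwinnertonDyer.Rank1Residual
open Summit.BirchSwinnertonDyer.Rank1Residual.X11b.FiniteDuality
open Summit.BirchSwinnertonDyer.Rank1Residual.X11b.Relaxation
open Summit.BirchSwinnertonDyer.Rank1Residual.X11b.LocBridge

/-! ## §3 THE ENGINE: KMR Theorem 3.9 for the Kummer structure of `E[2]` and a second `q`-isotropic structure -/

section Engine

variable {K : Type} [Field K] [NumberField K] (W : WeierstrassCurve K) [W.IsElliptic]
variable (e : geomTorsion W ((2 : ℕ) : ℤ) → geomTorsion W ((2 : ℕ) : ℤ) → AlgebraicClosure K)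
  (hμ : ∀ S T, e S T ^ 2 = 1)
  (hadd₁ : ∀ S₁ S₂ T, e (S₁ + S₂) T = e S₁ T * e S₂ T)
  (hadd₂ : ∀ S T₁ T₂, e S (T₁ + T₂) = e S T₁ * e S T₂)
  (hgal : ∀ (σ : absoluteGaloisGroup K) (S T : geomTorsion W ((2 : ℕ) : ℤ)), σ • e S T = e (σ • S) (σ • T))
  (halt : ∀ T, e T T = 1) (hnondeg : ∀ T, (∀ S, e S T = 1) → T = 0)
  (inv : LocalInvariants K 2)

include halt hnondeg in
/-- **THE ENGINE — Klagsbrun–Mazur–Rubin Theorem 3.9 for `E[2]` with Poonen–Rains-type quadratic forms.**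
Let `E = W` be elliptic over a number field `K`, `e` a Weil pairing on `E[2]`, `inv` a family of local invariant
maps at level `2` with the five Poitou–Tate properties (`IsPerfect`, `SumLocalTermEqZero`, `SelmerComplement`,
`InjectiveAtRealPlaces`; these are exactly the conjuncts of the tree's `poitouTate_selmerStructure_duality_real K`)
and Tate's local Euler characteristic at the finite places. SUPPOSE GIVEN, at every place `v`, a function
`q_v : H¹(K_v, E[2]) → ℤ/2` with
* (Q1) polarisation `q_v(x+y) − q_v(x) − q_v(y) = inv_v(x ∪ₑ y)` (a TATE quadratic form, KMR Def. 3.2),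
* (Q2) `q_v = 0` on the local Kummer condition `𝓚_v = im(E(K_v)/2)` (Poonen–Rains Prop. 4.11),
* (Q3) reciprocity `∑_{v∈S} q_v(c_v) = 0` for global `c` whenever the `q_v(c_v)` vanish off `S` (KMR Def. 3.3 (iii)),
and a second Selmer structure `𝓐` on `E[2]` that agrees with `𝓚` off a finite set `S`, is `q`-isotropic, and has
`#𝓐_v = #𝓚_v` on `S`. THEN `#H¹_𝓐(K, E[2]) · #H¹_𝓚(K, E[2]) · ∏_{v∈S} [𝓚_v : 𝓐_v ∩ 𝓚_v]` is a perfect square,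
i.e. `d(𝓐) ≡ d(𝓚) + ∑_v dim 𝓚_v/(𝓚_v ∩ 𝓐_v) (mod 2)`. Proof: the `q_v` form a global metabolic structure on
`H¹(K, E[2])` (KMR Def. 3.3) with "unramified" subspaces `Λ_v := 𝓚_v` (Lagrangian at EVERY place: own annihilator
by X5 `dualTransported_kummerSelmerStructure_eq` + isotropy (Q2)); `𝓚` and `𝓐` are quadratic Selmer structures for
it (Def. 3.8; `𝓐_v` Lagrangian by isotropy + order); the Poitou–Tate input `Z^⊥ = Z` is §2; then the tree's KMR
Thm. 3.9 `QuadraticSelmerStructure.even_of_natCard_selmerGroup_eq_pow`.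
[cite: KlagsbrunMazurRubin2013, Def. 3.3, Def. 3.8 and Thm. 3.9] [cite: PoonenRains2012, Prop. 4.11 and Thm. 4.14]
[cite: MilneADT2006, Ch. I, Thm. 4.10(b)] -/
theorem isSquare_card_selmerGroup_mul_of_tateQuadraticForms (hperf : inv.IsPerfect) (hsum : inv.SumLocalTermEqZero)
    (hcompl : inv.SelmerComplement) (hreal : inv.InjectiveAtRealPlaces)
    (hEP : ∀ v : HeightOneSpectrum (𝓞 K), localEulerPoincareCharacteristic (v.adicCompletion K))
    (q : ∀ v : Place K, galoisCohomology ((W.torsionGaloisModule ((2 : ℕ) : ℤ)).toLocal v) 1 → ZMod 2)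
    (hpolar : ∀ v x y, q v (x + y) = q v x + q v y + invWeilPairing W 2 e hμ hadd₁ hadd₂ hgal inv v x y)
    (hisoK : ∀ v, ∀ x ∈ W.kummerSelmerStructure ((2 : ℕ) : ℤ) v, q v x = 0)
    (hrec : ∀ (c : galoisCohomology (W.torsionGaloisModule ((2 : ℕ) : ℤ)) 1) (S : Finset (Place K)),
      (∀ v ∉ S, q v (galoisCohomology.localization (W.torsionGaloisModule ((2 : ℕ) : ℤ)) v 1 c) = 0) →
        ∑ v ∈ S, q v (galoisCohomology.localization (W.torsionGaloisModule ((2 : ℕ) : ℤ)) v 1 c) = 0)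
    (𝓐 : SelmerStructure (W.torsionGaloisModule ((2 : ℕ) : ℤ))) (S : Finset (Place K))
    (hS : ∀ v ∉ S, 𝓐 v = W.kummerSelmerStructure ((2 : ℕ) : ℤ) v) (hisoA : ∀ v, ∀ x ∈ 𝓐 v, q v x = 0)
    (hcardA : ∀ v ∈ S, Nat.card (𝓐 v) = Nat.card (W.kummerSelmerStructure ((2 : ℕ) : ℤ) v)) :
    IsSquare (Nat.card 𝓐.selmerGroup * Nat.card (W.kummerSelmerStructure ((2 : ℕ) : ℤ)).selmerGroup *
      ∏ v ∈ S, (𝓐 v).relIndex (W.kummerSelmerStructure ((2 : ℕ) : ℤ) v)) := by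
  classical
  haveI := finite_geomTorsion_of_neZero W 2
  -- notation (`let`, not `set`: the hypotheses keep their statements)
  let M := W.torsionGaloisModule ((2 : ℕ) : ℤ)
  let 𝓚 : SelmerStructure M := W.kummerSelmerStructure ((2 : ℕ) : ℤ)
  let loc : ∀ v : Place K, galoisCohomology M 1 →+ galoisCohomology (M.toLocal v) 1 :=
    fun v => galoisCohomology.localization M v 1
  let b : ∀ v : Place K, galoisCohomology (M.toLocal v) 1 →+ galoisCohomology (M.toLocal v) 1 →+ ZMod 2 :=
    fun v => invWeilPairing W 2 e hμ hadd₁ hadd₂ hgal inv v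
  -- finiteness and `2`-torsion
  haveI hfinL : ∀ v, Finite (galoisCohomology (M.toLocal v) 1) := finite_galoisCohomology_toLocal W 2
  have h2L : ∀ v (x : galoisCohomology (M.toLocal v) 1), 2 • x = 0 := X11b.KummerPT.nsmul_galoisCohomology_toLocal_eq_zero W 2
  have h2H : ∀ x : galoisCohomology M 1, 2 • x = 0 := nsmul_galoisCohomology W 2
  -- the `𝔽₂`-structures
  letI instH : Module (ZMod 2) (galoisCohomology M 1) := AddCommGroup.zmodModule h2H
  letI instL : ∀ v, Module (ZMod 2) (galoisCohomology (M.toLocal v) 1) := fun v => AddCommGroup.zmodModule (h2L v)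
  haveI hfdL : ∀ v, Module.Finite (ZMod 2) (galoisCohomology (M.toLocal v) 1) := fun v => Module.Finite.of_finite
  -- the quadratic forms
  have hQ : ∀ v, ∃ Q : QuadraticForm (ZMod 2) (galoisCohomology (M.toLocal v) 1),
      (∀ x, Q x = q v x) ∧ ∀ x y, polarForm Q x y = b v x y := fun v => exists_quadraticForm_of_polar (q v) (b v) (hpolar v)
  choose Q hQq hQb using hQ
  -- per-place duality facts
  have hann : ∀ v, annRight (b v) (𝓚 v) = 𝓚 v :=
    annRight_invWeilPairing_kummerSelmerStructure_eq W 2 e hμ hadd₁ hadd₂ hgal halt hnondeg inv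
      Nat.prime_two.isPrimePow hperf hEP hreal
  have hinj : ∀ v, Injective (b v) := invWeilPairing_injective W 2 e hμ hadd₁ hadd₂ hgal halt hnondeg inv hperf hreal
  have hnd : ∀ v, (polarForm (Q v)).Nondegenerate := fun v => nondegenerate_of_injective (Q v) (b v) (hQb v) (hinj v)
  -- `Λ_v := 𝓚_v`, Lagrangian everywhere
  let Λ : ∀ v : Place K, Submodule (ZMod 2) (galoisCohomology (M.toLocal v) 1) :=
    fun v => AddSubgroup.toZModSubmodule 2 (𝓚 v)
  have hLagK : ∀ v, IsLagrangian (Q v) (Λ v) := fun v =>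
    isLagrangian_of_annRight_eq (Q v) (b v) (hQb v) (𝓚 v) (hann v) (fun x hx => by rw [hQq]; exact hisoK v x hx)
  let locL : ∀ v : Place K, galoisCohomology M 1 →ₗ[ZMod 2] galoisCohomology (M.toLocal v) 1 :=
    fun v => (loc v).toZModLinearMap 2
  have hlocL : ∀ v c, locL v c = loc v c := fun v c => rfl
  -- the global metabolic structure (KMR Def. 3.3), `S₀ = ∅`
  let 𝓆 : GlobalMetabolicStructure locL Λ ∅ :=
    { form := Q
      isMetabolic := fun v => ⟨hnd v, Λ v, hLagK v⟩
      isLagrangian_unramified := fun v _ => hLagK v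
      sum_eq_zero := fun T _ c hc => by
        have h := hrec c T (fun v hv => hisoK v _ (hc v hv))
        simp only [hQq, hlocL]
        exact h }
  -- `unramifiedOutside locL Λ T = kummerOutside W 2 T`
  have hUO : ∀ (T : Finset (Place K)) (c : galoisCohomology M 1),
      c ∈ unramifiedOutside locL Λ T ↔ c ∈ kummerOutside W 2 T := by
    intro T c
    rw [mem_unramifiedOutside_iff, mem_kummerOutside_iff]
    exact Iff.rfl
  -- finiteness of the classes unramified outside `T`
  have hfin : ∀ T : Finset (Place K), FiniteDimensional (ZMod 2) (unramifiedOutside locL Λ T) := by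
    intro T
    haveI : Finite (kummerOutside W 2 T) := X11b.SelmerLevelBound.finite_kummerOutside W 2 T
    haveI : Finite (unramifiedOutside locL Λ T) :=
      Finite.of_equiv (kummerOutside W 2 T) (Equiv.subtypeEquivRight fun c => (hUO T c).symm)
    exact Module.Finite.of_finite
  -- symmetry of the local pairings (they are polar forms)
  have hsymm : ∀ v x y, b v x y = b v y x := fun v x y => by
    rw [← hQb, ← hQb, polarForm_apply, polarForm_apply, QuadraticMap.polar_comm]
  -- the Poitou–Tate input `Z^⊥ = Z` (KMR: "by Poitou–Tate global duality")
  have hPT : ∀ T : Finset (Place K), 𝓆.IsSelfDualAt T := by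
    intro T
    apply le_antisymm
    · -- `Z^⊥ ≤ Z`: §2
      intro y hy
      rw [LinearMap.BilinForm.mem_orthogonal_iff] at hy
      let t : ∀ v : Place K, galoisCohomology (M.toLocal v) 1 := fun v => if h : v ∈ T then y ⟨v, h⟩ else 0
      have ht : ∀ v (h : v ∈ T), t v = y ⟨v, h⟩ := fun v h => dif_pos h
      obtain ⟨x, hx, hxt⟩ := exists_mem_kummerOutside_localization_eq W 2 e hμ hadd₁ hadd₂ hgal halt hnondeg inv
        Nat.prime_two.isPrimePow hperf hcompl hEP hreal T t (fun c hc => by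
          have hz : locPi locL T c ∈ globalImage locL Λ T :=
            Submodule.mem_map_of_mem ((hUO T c).mpr hc)
          have h0 := hy _ hz
          rw [GlobalMetabolicStructure.piForm, polarForm_pi_apply] at h0
          rw [← Finset.sum_coe_sort T (fun v => b v (t v) (loc v c))]
          refine (Finset.sum_congr rfl fun v _ => ?_).trans h0
          rw [hQb, locPi_apply, hlocL, ht v.1 v.2, hsymm])
      refine ⟨x, (hUO T x).mpr hx, funext fun v => ?_⟩
      rw [locPi_apply, hlocL, hxt v.1 v.2, ht v.1 v.2]
    · -- `Z ≤ Z^⊥`: isotropy of the global image (Poitou–Tate vanishing + isotropy of `𝓚_v` off `T`)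
      intro y hy
      rw [LinearMap.BilinForm.mem_orthogonal_iff]
      intro z hz
      obtain ⟨c, hc, rfl⟩ := Submodule.mem_map.mp hz
      obtain ⟨c', hc', rfl⟩ := Submodule.mem_map.mp hy
      rw [GlobalMetabolicStructure.piForm, polarForm_pi_apply]
      have h0 := X11b.KummerPT.sum_invWeilPairing_localization_eq_zero_of_mem_kummerOutside W 2 e hμ hadd₁ hadd₂ hgal
        halt inv hsum T ((hUO T c).mp hc) ((hUO T c').mp hc')
      rw [← Finset.sum_coe_sort T] at h0
      refine (Finset.sum_congr rfl fun v _ => ?_).trans h0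
      rw [hQb, locPi_apply, locPi_apply, hlocL, hlocL]
  -- the two quadratic Selmer structures (KMR Def. 3.8): `𝓚` (places `∅`) and `𝓐` (places `S`)
  let Λ' : ∀ v : Place K, Submodule (ZMod 2) (galoisCohomology (M.toLocal v) 1) :=
    fun v => AddSubgroup.toZModSubmodule 2 (𝓐 v)
  have hLagA : ∀ v ∈ S, IsLagrangian (Q v) (Λ' v) := fun v hv =>
    isLagrangian_of_isotropic_of_natCard_eq (Q v) (hnd v) (hLagK v) (fun x hx => by rw [hQq]; exact hisoA v x hx)
      (hcardA v hv)
  let 𝒮K : QuadraticSelmerStructure 𝓆 :=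
    { places := ∅
      subset_places := le_rfl
      W := Λ
      isLagrangian_of_mem := fun v _ => hLagK v
      eq_unramified := fun v _ => rfl }
  let 𝒮A : QuadraticSelmerStructure 𝓆 :=
    { places := S
      subset_places := Finset.empty_subset S
      W := Λ'
      isLagrangian_of_mem := hLagA
      eq_unramified := fun v hv => by
        change AddSubgroup.toZModSubmodule 2 (𝓐 v) = AddSubgroup.toZModSubmodule 2 (𝓚 v)
        rw [hS v hv] }
  -- their Selmer groups are `H¹_𝓚` and `H¹_𝓐`
  have hSelK : ∀ c, c ∈ 𝒮K.selmerGroup ↔ c ∈ 𝓚.selmerGroup := fun c => by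
    rw [QuadraticSelmerStructure.mem_selmerGroup_iff, SelmerStructure.mem_selmerGroup_iff]; exact Iff.rfl
  have hSelA : ∀ c, c ∈ 𝒮A.selmerGroup ↔ c ∈ 𝓐.selmerGroup := fun c => by
    rw [QuadraticSelmerStructure.mem_selmerGroup_iff, SelmerStructure.mem_selmerGroup_iff]; exact Iff.rfl
  have hcardK : Nat.card 𝒮K.selmerGroup = Nat.card 𝓚.selmerGroup :=
    Nat.card_congr (Equiv.subtypeEquivRight hSelK)
  have hcardA' : Nat.card 𝒮A.selmerGroup = Nat.card 𝓐.selmerGroup :=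
    Nat.card_congr (Equiv.subtypeEquivRight hSelA)
  -- finiteness of the Selmer groups (inside the finite `kummerOutside W 2 S`)
  haveI : Finite (kummerOutside W 2 S) := X11b.SelmerLevelBound.finite_kummerOutside W 2 S
  have hKle : 𝓚.selmerGroup ≤ kummerOutside W 2 S := fun c hc =>
    (mem_kummerOutside_iff W 2 S c).mpr fun v _ => (SelmerStructure.mem_selmerGroup_iff _ c).mp hc v
  have hAle : 𝓐.selmerGroup ≤ kummerOutside W 2 S := fun c hc =>
    (mem_kummerOutside_iff W 2 S c).mpr fun v hv => by
      have h := (SelmerStructure.mem_selmerGroup_iff _ c).mp hc v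
      rw [hS v hv] at h
      exact h
  haveI : Finite 𝓚.selmerGroup := Finite.of_injective _ (AddSubgroup.inclusion_injective hKle)
  haveI : Finite 𝓐.selmerGroup := Finite.of_injective _ (AddSubgroup.inclusion_injective hAle)
  haveI : Finite 𝒮K.selmerGroup := Finite.of_equiv _ (Equiv.subtypeEquivRight hSelK).symm
  haveI : Finite 𝒮A.selmerGroup := Finite.of_equiv _ (Equiv.subtypeEquivRight hSelA).symm
  have hsK := natCard_eq_two_pow_finrank 𝒮K.selmerGroup
  have hsA := natCard_eq_two_pow_finrank 𝒮A.selmerGroup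
  -- KMR Theorem 3.9
  have hKMR := QuadraticSelmerStructure.even_of_natCard_selmerGroup_eq_pow 𝒮K 𝒮A (S := S)
    (Finset.empty_subset S) le_rfl (hfin S) (hPT S) hsK hsA
  obtain ⟨k, hk⟩ := hKMR
  -- the local indices
  have hidx : ∀ v ∈ S, (𝓐 v).relIndex (𝓚 v) =
      2 ^ (finrank (ZMod 2) (𝒮K.W v) - finrank (ZMod 2) ↥(𝒮K.W v ⊓ 𝒮A.W v)) := fun v _ =>
    relIndex_eq_two_pow (𝓐 v) (𝓚 v)
  refine ⟨2 ^ k, ?_⟩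
  rw [← hcardA', ← hcardK, hsA, hsK, Finset.prod_congr rfl hidx, Finset.prod_pow_eq_pow_sum, ← pow_add, ← pow_add,
    ← pow_add]
  congr 1
  omega

end Engine

/-! ## §4 Kramer parity from a Tate-quadratic-form datum -/

section Kramer

variable {K : Type} [Field K] [NumberField K]

/-- **KRAMER'S PARITY (Mazur–Rubin 2010 Thm. 2.7 = Kramer 1981 Thm. 1, every number field, `p = 2`) FROM A
TATE-QUADRATIC-FORM DATUM AT `2`.** Let `inv` be a family of local invariant maps at level `2` with the five
Poitou–Tate properties (the conjuncts of `poitouTate_selmerStructure_duality_real K`), and Tate's local Euler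
characteristic at the finite places. Suppose that for every elliptic `E = W` over `K` we are GIVEN a Weil pairing
`e` on `E[2]` and functions `q_v : H¹(K_v, E[2]) → ℤ/2` (all places `v`) such that
(Q1) `q_v(x+y) − q_v(x) − q_v(y) = inv_v(x ∪ₑ y)`; (Q2) `q_v` vanishes on the local Kummer condition of `E`;
(Q3) `∑_{v∈S} q_v(c_v) = 0` for global `c` whenever the `q_v(c_v)` vanish off `S`; (Q4) `q_v` vanishes on the local
Kummer condition of every quadratic twist `E^F` transported into `H¹(K_v, E[2])` along the identification
`E^F[2] = E[2]` (binders verbatim as in `MazurRubin2010.kramerParity`). THEN `MazurRubin2010.kramerParity K` holds: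
the engine (§3) with `#𝓐_v = #𝓚_v` (both squared equal `#H¹(K_v, E[2])`, transport along `E^F[2] ≅ E[2]`) and
`#H¹_𝓐 = #Sel₂(E^F)` (X11b `natCard_selmerGroup_of_transport`). The datum (Q1)–(Q4) is the arithmetic content of
Poonen–Rains 2012 §4 (Prop. 4.9/4.11, Thm. 4.14) — NOT proved here: this theorem is the `q`-independent half
(KMR 2013 Thm. 3.9 and Lemma 5.2) of the printed proof of Kramer's congruence via quadratic Selmer structures.
[cite: MazurRubin2010, Thm. 2.7 with Lemma 2.9] [cite: KlagsbrunMazurRubin2013, Thm. 3.9] [cite: PoonenRains2012, Thm. 4.14] -/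
theorem kramerParity_of_tateQuadraticForms (inv : LocalInvariants K 2) (hperf : inv.IsPerfect)
    (hsum : inv.SumLocalTermEqZero) (hcompl : inv.SelmerComplement) (hreal : inv.InjectiveAtRealPlaces)
    (hEP : ∀ v : HeightOneSpectrum (𝓞 K), localEulerPoincareCharacteristic (v.adicCompletion K))
    (hq : ∀ (W : WeierstrassCurve K) [W.IsElliptic],
      ∃ (e : geomTorsion W ((2 : ℕ) : ℤ) → geomTorsion W ((2 : ℕ) : ℤ) → AlgebraicClosure K)
        (hμ : ∀ S T, e S T ^ 2 = 1)
        (hadd₁ : ∀ S₁ S₂ T, e (S₁ + S₂) T = e S₁ T * e S₂ T)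
        (hadd₂ : ∀ S T₁ T₂, e S (T₁ + T₂) = e S T₁ * e S T₂)
        (hgal : ∀ (σ : absoluteGaloisGroup K) (S T : geomTorsion W ((2 : ℕ) : ℤ)), σ • e S T = e (σ • S) (σ • T))
        (_halt : ∀ T, e T T = 1) (_hnondeg : ∀ T, (∀ S, e S T = 1) → T = 0)
        (q : ∀ v : Place K, galoisCohomology ((W.torsionGaloisModule ((2 : ℕ) : ℤ)).toLocal v) 1 → ZMod 2),
        (∀ v x y, q v (x + y) = q v x + q v y + invWeilPairing W 2 e hμ hadd₁ hadd₂ hgal inv v x y) ∧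
        (∀ v, ∀ x ∈ W.kummerSelmerStructure ((2 : ℕ) : ℤ) v, q v x = 0) ∧
        (∀ (c : galoisCohomology (W.torsionGaloisModule ((2 : ℕ) : ℤ)) 1) (S : Finset (Place K)),
          (∀ v ∉ S, q v (galoisCohomology.localization (W.torsionGaloisModule ((2 : ℕ) : ℤ)) v 1 c) = 0) →
            ∑ v ∈ S, q v (galoisCohomology.localization (W.torsionGaloisModule ((2 : ℕ) : ℤ)) v 1 c) = 0) ∧
        (∀ (d : K), (∀ x : K, x ^ 2 ≠ d) → ∀ (W' : WeierstrassCurve K) [W'.IsElliptic],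
          (∃ C : VariableChange K, C • W' = W.quadraticTwist d) →
          ∀ (φ : (W'.torsionGaloisModule ((2 : ℕ) : ℤ)).toContRepresentation →ⁱL
              (W.torsionGaloisModule ((2 : ℕ) : ℤ)).toContRepresentation),
            Function.Injective φ →
            (∀ φ' : (W'.torsionGaloisModule ((2 : ℕ) : ℤ)).toContRepresentation →ⁱL
                (W.torsionGaloisModule ((2 : ℕ) : ℤ)).toContRepresentation,
              Function.Injective φ' → ∀ a, φ' a = φ a) →
          ∀ (𝓐 : SelmerStructure (W.torsionGaloisModule ((2 : ℕ) : ℤ))),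
            (∀ v, 𝓐 v = (W'.kummerSelmerStructure ((2 : ℕ) : ℤ) v).map
              (galoisCohomology.map (φ.restrictField (Place.Completion v)) 1)) →
            ∀ v, ∀ x ∈ 𝓐 v, q v x = 0)) :
    MazurRubin2010.kramerParity K := by
  intro W _ d hd W' _ hC φ hφ huniq 𝓐 h𝓐 S hS
  classical
  haveI : PerfectField K := PerfectField.ofCharZero
  obtain ⟨e, hμ, hadd₁, hadd₂, hgal, halt, hnondeg, q, hpolar, hisoK, hrec, hisoA⟩ := hq W
  -- a Weil pairing on `E^F[2]` (tree theorem)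
  obtain ⟨e', hμ', hadd₁', hadd₂', halt', hnondeg', hgal'⟩ :=
    exists_weilPairing_holds W' 2 le_rfl (by norm_num)
  -- `φ` is bijective (`#E^F[2] = #E[2] = 4`); its inverse
  have hcard : Nat.card (geomTorsion W' ((2 : ℕ) : ℤ)) = Nat.card (geomTorsion W ((2 : ℕ) : ℤ)) := by
    rw [W'.natCard_geomTorsion (n := ((2 : ℕ) : ℤ)) (by norm_num), W.natCard_geomTorsion (n := ((2 : ℕ) : ℤ)) (by norm_num)]
  haveI : Finite (geomTorsion W ((2 : ℕ) : ℤ)) := finite_geomTorsion_of_neZero W 2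
  haveI : Finite (geomTorsion W' ((2 : ℕ) : ℤ)) := finite_geomTorsion_of_neZero W' 2
  have hbij : Bijective φ := hφ.bijective_of_nat_card_le hcard.ge
  obtain ⟨ψ, hψφ, hφψ⟩ := exists_inverse_of_bijective φ hbij
  -- `#H¹_𝓐 = #Sel₂(E^F)` and `Sel₂(E) = H¹_𝓚`
  have hSelA : Nat.card 𝓐.selmerGroup = Nat.card (W'.selmerGroup ((2 : ℕ) : ℤ)) := by
    rw [W'.selmerGroup_eq_selmerGroup_kummerSelmerStructure]
    exact X11b.CongruentTransfer.natCard_selmerGroup_of_transport _ φ ψ hψφ hφψ 𝓐 h𝓐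
  have hSelK : Nat.card (W.selmerGroup ((2 : ℕ) : ℤ)) =
      Nat.card (W.kummerSelmerStructure ((2 : ℕ) : ℤ)).selmerGroup :=
    Nat.card_congr (Equiv.subtypeEquivRight fun c =>
      (W.mem_selmerGroup_iff_forall_localization_mem _ c).trans
        ((W.kummerSelmerStructure ((2 : ℕ) : ℤ)).mem_selmerGroup_iff c).symm)
  -- `#𝓐_v = #𝓚_v`
  have hcardA : ∀ v ∈ S, Nat.card (𝓐 v) = Nat.card (W.kummerSelmerStructure ((2 : ℕ) : ℤ) v) := by
    intro v _
    have h1 : Nat.card (𝓐 v) = Nat.card (W'.kummerSelmerStructure ((2 : ℕ) : ℤ) v) := by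
      rw [h𝓐 v]
      exact Nat.card_congr (AddSubgroup.equivMapOfInjective _ _
        (X11b.CongruentTransfer.map_restrictField_injective_of_comp_eq φ ψ hψφ v)).toEquiv.symm
    have h2 : Nat.card (galoisCohomology ((W'.torsionGaloisModule ((2 : ℕ) : ℤ)).toLocal v) 1) =
        Nat.card (galoisCohomology ((W.torsionGaloisModule ((2 : ℕ) : ℤ)).toLocal v) 1) := by
      refine Nat.card_eq_of_bijective (galoisCohomology.map (φ.restrictField (Place.Completion v)) 1) ⟨?_, ?_⟩
      · exact X11b.CongruentTransfer.map_restrictField_injective_of_comp_eq φ ψ hψφ v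
      · intro y
        exact ⟨galoisCohomology.map (ψ.restrictField (Place.Completion v)) 1 y,
          X11b.CongruentTransfer.map_restrictField_map_restrictField_of_comp_eq ψ φ hφψ v y⟩
    have hW := natCard_kummerSelmerStructure_mul_self W 2 e hμ hadd₁ hadd₂ hgal halt hnondeg inv
      Nat.prime_two.isPrimePow hperf hEP hreal v
    have hW' := natCard_kummerSelmerStructure_mul_self W' 2 e' hμ' hadd₁' hadd₂' hgal' halt' hnondeg' inv
      Nat.prime_two.isPrimePow hperf hEP hreal v
    rw [h1]
    rw [h2, ← hW] at hW'
    exact Nat.mul_self_inj.mp hW'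
  have key := isSquare_card_selmerGroup_mul_of_tateQuadraticForms W e hμ hadd₁ hadd₂ hgal halt hnondeg inv hperf hsum
    hcompl hreal hEP q hpolar hisoK hrec 𝓐 S hS (hisoA d hd W' hC φ hφ huniq 𝓐 h𝓐) hcardA
  rw [hSelA, ← hSelK] at key
  exact key

end Kramer


end Summit.BirchSwinnertonDyer.BirchSwinnertonDyer.Theorems.GenusKolyKramer

end
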